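import Summits.QuantumFields.YangMills.Theses.LimitSetRigidity
import Summits.QuantumFields.YangMills.Theses.UVClassRigidity

/-!
# LINE 3 (ideator ym-r3-idea-1 g5) — SECOND registered skeleton for crux B `IsolatedLimitPointsL` (stmt-QuantumFields-27351):
# the TORUS-NATIVE engine «LINE 2 made local».

`IsolatedLimitPointsL` ⟸ STUB 1 (= `UVClassRigidity.LimitTrajectoriesUVEquivalent`, LINE 2's item stmt-QuantumFields-26905, restated
VERBATIM — `stub1_iff` is `Iff.rfl`) ∧ STUB 2 `stub_localUVRigidity` (new: LINE 2's binding crux `UVRigidity`, stmt-QuantumFields-26904 —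
GLOBAL: any two UV-equivalent consistent trajectories, one realised, have equal unit integrals — WEAKENED to LOCAL form: both realised AND
ρ-close on a finite test set T ⇒ equal; `localUVRigidity_of_uvRigidity : UVRigidity → STUB 2` is kernel-checked below).  So LINE 3 = LINE 2
with global rigidity relaxed to local rigidity, the slack bought by the rate-free crux A `SlowVariationL` and Ostrowski's principle in `closes`.
This skeleton needs no autonomous RG map on the torus (the objection to the IFT plan of `Lines/limitset_rigidity_birth_B.lean`): the objects
are Bałaban's UV-equivalence classes of CONSISTENT TRAJECTORIES on the nested torus lattices (`descend`, `fieldMeasure`, `PlaqSmall`, per-bond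
oscillation ω_j, clustering rate κ, large-field masses η_j — tree vocabulary of `T3NestedUnitLaws` / p618114 `BalabanUVClass`).
No summit, rung or crux is proved here: two `sorry` stubs, one kernel-checked composition, two kernel-checked comparison lemmas.
-/

namespace Summit.QuantumFields.YangMills.Theses.LimitSetRigidity

namespace Cruxes.IsolatedLimitPointsL.Birth2

/-- STUB 1 (L; = LINE 2's item stmt-QuantumFields-26905 verbatim, see `stub1_iff`): limit trajectories are pairwise UV-equivalent. -/
theorem stub_limitTrajectoriesUVEquivalent :
    open MeasureTheory Filter Topology Literature.MathematicalPhysics.QuantumFieldTheory.Balaban1983to89 Literature.MathematicalPhysics.QuantumFieldTheory.Balaban1983to89.T3ContinuumYM3Torus Literature.MathematicalPhysics.QuantumFieldTheory.Balaban1983to89.T3NestedUnitLaws Literature.MathematicalPhysics.QuantumFieldTheory.Balaban1983to89.T3UnitLawDensityEML Literature.MathematicalPhysics.QuantumFieldTheory.Balaban1983to89.T4Continuum in ∃ γ₁ : ℝ, 0 < γ₁ ∧ ∀ (F : T3Family) (γ : ℝ), 0 < γ → γ ≤ γ₁ → ∃ (κ : ℝ) (j₀ : ℕ) (δ ω η :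 ℕ → ℝ), 0 < κ ∧ (∀ j, 0 < δ j ∧ 0 ≤ ω j ∧ 0 ≤ η j) ∧ Summable ω ∧ Summable η ∧ ∀ φ φ' : ℕ → ℕ, StrictMono φ → StrictMono φ' → ∃ ψ ψ' : ℕ → ℕ, StrictMono ψ ∧ StrictMono ψ' ∧ ∃ μ μ' : ((j : ℕ) → MeasureTheory.Measure (GaugeField (F.P j) 0 ↥(Matrix.specialUnitaryGroup (Fin 2) ℂ))), (∀ j : ℕ, IsProbabilityMeasure (μ j) ∧ μ j = Measure.map (descend F ℰp j) (μ (j + 1))) ∧ (∀ j : ℕ, IsProbabilityMeasure (μ' j) ∧ μ' j = Measure.map (descend F ℰp j) (μ' (j + 1))) ∧ (StrictMono (φ ∘ ψ) ∧ ∀ os : List (ULoop3 F), Tendsto (fun i => (F.scheme ℰp γ).expectAt ((φ ∘ ψ) i) os) atTop (𝓝 (∫ u, (os.map fun C => loopAt u (C.1.atLevel 0)).prod ∂(μ 0)))) ∧ (StrictMono (φ' ∘ ψ') ∧ ∀ os : List (ULoop3 F), Tendsto (fun i => (F.scheme ℰp γ).expectAt ((φ' ∘ ψ') i) os) atTop (𝓝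 (∫ u, (os.map fun C => loopAt u (C.1.atLevel 0)).prod ∂(μ' 0)))) ∧ (∀ j : ℕ, j₀ ≤ j → ∃ r r' : GaugeField (F.P j) 0 ↥(Matrix.specialUnitaryGroup (Fin 2) ℂ) → ℝ, Measurable r ∧ Measurable r' ∧ (∀ U, 0 ≤ r U ∧ 0 ≤ r' U) ∧ (∀ U, PlaqSmall (δ j) U → 0 < r U ∧ 0 < r' U) ∧ μ j = (fieldMeasure (F.P j) 0 ↥(Matrix.specialUnitaryGroup (Fin 2) ℂ)).withDensity (fun U => ENNReal.ofReal (r U)) ∧ μ' j = (fieldMeasure (F.P j) 0 ↥(Matrix.specialUnitaryGroup (Fin 2) ℂ)).withDensity (fun U => ENNReal.ofReal (r' U)) ∧ (∀ (b : PBond (F.P j) 0) (U V : GaugeField (F.P j) 0 ↥(Matrix.specialUnitaryGroup (Fin 2) ℂ)), PlaqSmall (δ j) U → PlaqSmall (δ j) V → (∀ c : PBond (F.P j) 0, c ≠ b → U c = V c) → |(Real.log (r U) - Real.log (r' U)) - (Real.log (r V) - Real.log (r' V))| ≤ ω j) ∧ (∀ (b b' : PBond (F.P j) 0) (U V W Z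 : GaugeField (F.P j) 0 ↥(Matrix.specialUnitaryGroup (Fin 2) ℂ)), PlaqSmall (δ j) U → PlaqSmall (δ j) V → PlaqSmall (δ j) W → PlaqSmall (δ j) Z → (∀ c : PBond (F.P j) 0, c ≠ b → U c = V c) → (∀ c : PBond (F.P j) 0, c ≠ b' → U c = W c) → (∀ c : PBond (F.P j) 0, c ≠ b' → V c = Z c) → (∀ c : PBond (F.P j) 0, c ≠ b → W c = Z c) → |((Real.log (r U) - Real.log (r' U)) - (Real.log (r V) - Real.log (r' V))) - ((Real.log (r W) - Real.log (r' W)) - (Real.log (r Z) - Real.log (r' Z)))| ≤ ω j * Real.exp (-(κ * (b.src.tdist b'.src : ℝ)))) ∧ μ j {U | ¬ PlaqSmall (δ j) U} ≤ ENNReal.ofReal (η j) ∧ μ' j {U | ¬ PlaqSmall (δ j) U} ≤ ENNReal.ofReal (η j)) := by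
  sorry

/-- `stub_limitTrajectoriesUVEquivalent` IS `UVClassRigidity.LimitTrajectoriesUVEquivalent` (26905): a proof of either closes the other. -/
theorem stub1_iff :
    (open MeasureTheory Filter Topology Literature.MathematicalPhysics.QuantumFieldTheory.Balaban1983to89 Literature.MathematicalPhysics.QuantumFieldTheory.Balaban1983to89.T3ContinuumYM3Torus Literature.MathematicalPhysics.QuantumFieldTheory.Balaban1983to89.T3NestedUnitLaws Literature.MathematicalPhysics.QuantumFieldTheory.Balaban1983to89.T3UnitLawDensityEML Literature.MathematicalPhysics.QuantumFieldTheory.Balaban1983to89.T4Continuum in ∃ γ₁ : ℝ, 0 < γ₁ ∧ ∀ (F : T3Family) (γ : ℝ), 0 < γ → γ ≤ γ₁ → ∃ (κ : ℝ) (j₀ : ℕ) (δ ω η : ℕ → ℝ), 0 < κ ∧ (∀ j, 0 < δ j ∧ 0 ≤ ω j ∧ 0 ≤ η j) ∧ Summable ω ∧ Summable η ∧ ∀ φ φ' : ℕ → ℕ, StrictMono φ → StrictMono φ' → ∃ ψ ψ' : ℕ → ℕ, StrictMono ψ ∧ StrictMono ψ' ∧ ∃ μ μ' : ((j : ℕ)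 → MeasureTheory.Measure (GaugeField (F.P j) 0 ↥(Matrix.specialUnitaryGroup (Fin 2) ℂ))), (∀ j : ℕ, IsProbabilityMeasure (μ j) ∧ μ j = Measure.map (descend F ℰp j) (μ (j + 1))) ∧ (∀ j : ℕ, IsProbabilityMeasure (μ' j) ∧ μ' j = Measure.map (descend F ℰp j) (μ' (j + 1))) ∧ (StrictMono (φ ∘ ψ) ∧ ∀ os : List (ULoop3 F), Tendsto (fun i => (F.scheme ℰp γ).expectAt ((φ ∘ ψ) i) os) atTop (𝓝 (∫ u, (os.map fun C => loopAt u (C.1.atLevel 0)).prod ∂(μ 0)))) ∧ (StrictMono (φ' ∘ ψ') ∧ ∀ os : List (ULoop3 F), Tendsto (fun i => (F.scheme ℰp γ).expectAt ((φ' ∘ ψ') i) os) atTop (𝓝 (∫ u, (os.map fun C => loopAt u (C.1.atLevel 0)).prod ∂(μ' 0)))) ∧ (∀ j : ℕ, j₀ ≤ j → ∃ r r' : GaugeField (F.P j) 0 ↥(Matrix.specialUnitaryGroup (Fin 2) ℂ) → ℝ, Measurable r ∧ Measurable r' ∧ (∀ U, 0 ≤ r U ∧ 0 ≤ r' U) ∧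 (∀ U, PlaqSmall (δ j) U → 0 < r U ∧ 0 < r' U) ∧ μ j = (fieldMeasure (F.P j) 0 ↥(Matrix.specialUnitaryGroup (Fin 2) ℂ)).withDensity (fun U => ENNReal.ofReal (r U)) ∧ μ' j = (fieldMeasure (F.P j) 0 ↥(Matrix.specialUnitaryGroup (Fin 2) ℂ)).withDensity (fun U => ENNReal.ofReal (r' U)) ∧ (∀ (b : PBond (F.P j) 0) (U V : GaugeField (F.P j) 0 ↥(Matrix.specialUnitaryGroup (Fin 2) ℂ)), PlaqSmall (δ j) U → PlaqSmall (δ j) V → (∀ c : PBond (F.P j) 0, c ≠ b → U c = V c) → |(Real.log (r U) - Real.log (r' U)) - (Real.log (r V) - Real.log (r' V))| ≤ ω j) ∧ (∀ (b b' : PBond (F.P j) 0) (U V W Z : GaugeField (F.P j) 0 ↥(Matrix.specialUnitaryGroup (Fin 2) ℂ)), PlaqSmall (δ j) U → PlaqSmall (δ j) V → PlaqSmall (δ j) W → PlaqSmall (δ j) Z → (∀ c : PBond (F.P j) 0, c ≠ b → U c = V c) → (∀ c : PBond (F.P j) 0, c ≠ b' → U c = W c) → (∀ c : PBond (F.P j)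 0, c ≠ b' → V c = Z c) → (∀ c : PBond (F.P j) 0, c ≠ b → W c = Z c) → |((Real.log (r U) - Real.log (r' U)) - (Real.log (r V) - Real.log (r' V))) - ((Real.log (r W) - Real.log (r' W)) - (Real.log (r Z) - Real.log (r' Z)))| ≤ ω j * Real.exp (-(κ * (b.src.tdist b'.src : ℝ)))) ∧ μ j {U | ¬ PlaqSmall (δ j) U} ≤ ENNReal.ofReal (η j) ∧ μ' j {U | ¬ PlaqSmall (δ j) U} ≤ ENNReal.ofReal (η j)))
      ↔ Summit.QuantumFields.YangMills.Theses.UVClassRigidity.LimitTrajectoriesUVEquivalent := Iff.rfl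

/-- STUB 2 (L–XL, the hardest) LOCAL UV RIGIDITY: for all class parameters there are a finite test set `T` of unit loop strings and `ρ > 0`
such that two CONSISTENT trajectories, each REALISED along some cutoff subsequence of the (F, γ) Wilson runs, UV-EQUIVALENT with those
parameters, whose level-0 integrals are `ρ`-close on `T`, have equal level-0 integrals of every string.  Why plausible: two UV-equivalent
trajectories differ at every level j ≥ j₀ by a per-bond log-density oscillation ≤ ω_j (summable) with clustering; a Dobrushin-type contraction
ACROSS SCALES fed from the unit end (closeness given) and the UV end (ω_j → 0) should force equality — needed only in a ρ-neighbourhood,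
not globally as 26904 asks. -/
theorem stub_localUVRigidity :
    open MeasureTheory Filter Topology Literature.MathematicalPhysics.QuantumFieldTheory.Balaban1983to89 Literature.MathematicalPhysics.QuantumFieldTheory.Balaban1983to89.T3ContinuumYM3Torus Literature.MathematicalPhysics.QuantumFieldTheory.Balaban1983to89.T3NestedUnitLaws Literature.MathematicalPhysics.QuantumFieldTheory.Balaban1983to89.T3UnitLawDensityEML Literature.MathematicalPhysics.QuantumFieldTheory.Balaban1983to89.T4Continuum in ∃ γ₁ : ℝ, 0 < γ₁ ∧ ∀ (F : T3Family) (γ : ℝ), 0 < γ → γ ≤ γ₁ → ∀ (κ : ℝ) (j₀ : ℕ) (δ ω η : ℕ → ℝ), 0 < κ → (∀ j, 0 < δ j ∧ 0 ≤ ω j ∧ 0 ≤ η j) → Summable ω → Summable η → ∃ (T : Finset (List (ULoop3 F))) (ρ : ℝ), 0 < ρ ∧ ∀ (θ θ' : ℕ → ℕ) (μ μ' : ((j : ℕ) → MeasureTheory.Measure (GaugeField (F.P j) 0 ↥(Matrix.specialUnitaryGroup (Fin 2) ℂ)))),  (∀ j : ℕ, IsProbabilityMeasure (μ j) ∧ μ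 j = Measure.map (descend F ℰp j) (μ (j + 1))) → (∀ j : ℕ, IsProbabilityMeasure (μ' j) ∧ μ' j = Measure.map (descend F ℰp j) (μ' (j + 1))) → (StrictMono θ ∧ ∀ os : List (ULoop3 F), Tendsto (fun i => (F.scheme ℰp γ).expectAt (θ i) os) atTop (𝓝 (∫ u, (os.map fun C => loopAt u (C.1.atLevel 0)).prod ∂(μ 0)))) → (StrictMono θ' ∧ ∀ os : List (ULoop3 F), Tendsto (fun i => (F.scheme ℰp γ).expectAt (θ' i) os) atTop (𝓝 (∫ u, (os.map fun C => loopAt u (C.1.atLevel 0)).prod ∂(μ' 0)))) → (∀ j : ℕ, j₀ ≤ j → ∃ r r' : GaugeField (F.P j) 0 ↥(Matrix.specialUnitaryGroup (Fin 2) ℂ) → ℝ, Measurable r ∧ Measurable r' ∧ (∀ U, 0 ≤ r U ∧ 0 ≤ r' U) ∧ (∀ U, PlaqSmall (δ j) U → 0 < r U ∧ 0 < r' U) ∧ μ j = (fieldMeasure (F.P j) 0 ↥(Matrix.specialUnitaryGroup (Fin 2) ℂ)).withDensity (fun U => ENNReal.ofReal (r U)) ∧ μ' j = (fieldMeasure (F.P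 j) 0 ↥(Matrix.specialUnitaryGroup (Fin 2) ℂ)).withDensity (fun U => ENNReal.ofReal (r' U)) ∧ (∀ (b : PBond (F.P j) 0) (U V : GaugeField (F.P j) 0 ↥(Matrix.specialUnitaryGroup (Fin 2) ℂ)), PlaqSmall (δ j) U → PlaqSmall (δ j) V → (∀ c : PBond (F.P j) 0, c ≠ b → U c = V c) → |(Real.log (r U) - Real.log (r' U)) - (Real.log (r V) - Real.log (r' V))| ≤ ω j) ∧ (∀ (b b' : PBond (F.P j) 0) (U V W Z : GaugeField (F.P j) 0 ↥(Matrix.specialUnitaryGroup (Fin 2) ℂ)), PlaqSmall (δ j) U → PlaqSmall (δ j) V → PlaqSmall (δ j) W → PlaqSmall (δ j) Z → (∀ c : PBond (F.P j) 0, c ≠ b → U c = V c) → (∀ c : PBond (F.P j) 0, c ≠ b' → U c = W c) → (∀ c : PBond (F.P j) 0, c ≠ b' → V c = Z c) → (∀ c : PBond (F.P j) 0, c ≠ b → W c = Z c) → |((Real.log (r U) - Real.log (r' U)) - (Real.log (r V) - Real.log (r' V))) - ((Real.log (r W) - Real.log (r' W)) - (Real.log (r Z) - Real.log (r' Z)))|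 ≤ ω j * Real.exp (-(κ * (b.src.tdist b'.src : ℝ)))) ∧ μ j {U | ¬ PlaqSmall (δ j) U} ≤ ENNReal.ofReal (η j) ∧ μ' j {U | ¬ PlaqSmall (δ j) U} ≤ ENNReal.ofReal (η j)) → (∀ Cs ∈ T, |(∫ u, (Cs.map fun C => loopAt u (C.1.atLevel 0)).prod ∂(μ 0)) - (∫ u, (Cs.map fun C => loopAt u (C.1.atLevel 0)).prod ∂(μ' 0))| < ρ) → ∀ os : List (ULoop3 F), (∫ u, (os.map fun C => loopAt u (C.1.atLevel 0)).prod ∂(μ 0)) = (∫ u, (os.map fun C => loopAt u (C.1.atLevel 0)).prod ∂(μ' 0)) := by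
  sorry

open Filter Topology Literature.MathematicalPhysics.QuantumFieldTheory.Balaban1983to89
  Literature.MathematicalPhysics.QuantumFieldTheory.Balaban1983to89.T3ContinuumYM3Torus
  Literature.MathematicalPhysics.QuantumFieldTheory.Balaban1983to89.T3UnitLawDensityEML
  Literature.MathematicalPhysics.QuantumFieldTheory.Balaban1983to89.T3NestedUnitLaws
  Literature.MathematicalPhysics.QuantumFieldTheory.Balaban1983to89.T4Continuum in
/-- COMPOSITION (kernel-checked, no sorry): STUB 1 → STUB 2 → crux B of route LimitSetRigidity, BY NAME. -/
theorem IsolatedLimitPointsL_of₂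
    (h₁ : open MeasureTheory Filter Topology Literature.MathematicalPhysics.QuantumFieldTheory.Balaban1983to89 Literature.MathematicalPhysics.QuantumFieldTheory.Balaban1983to89.T3ContinuumYM3Torus Literature.MathematicalPhysics.QuantumFieldTheory.Balaban1983to89.T3NestedUnitLaws Literature.MathematicalPhysics.QuantumFieldTheory.Balaban1983to89.T3UnitLawDensityEML Literature.MathematicalPhysics.QuantumFieldTheory.Balaban1983to89.T4Continuum in ∃ γ₁ : ℝ, 0 < γ₁ ∧ ∀ (F : T3Family) (γ : ℝ), 0 < γ → γ ≤ γ₁ → ∃ (κ : ℝ) (j₀ : ℕ) (δ ω η : ℕ → ℝ), 0 < κ ∧ (∀ j, 0 < δ j ∧ 0 ≤ ω j ∧ 0 ≤ η j) ∧ Summable ω ∧ Summable η ∧ ∀ φ φ' : ℕ → ℕ, StrictMono φ → StrictMono φ' → ∃ ψ ψ' : ℕ → ℕ, StrictMono ψ ∧ StrictMono ψ' ∧ ∃ μ μ' : ((j : ℕ) → MeasureTheory.Measure (GaugeField (F.P j) 0 ↥(Matrix.specialUnitaryGroup (Fin 2) ℂ))), (∀ j : ℕ, IsProbabilityMeasure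 (μ j) ∧ μ j = Measure.map (descend F ℰp j) (μ (j + 1))) ∧ (∀ j : ℕ, IsProbabilityMeasure (μ' j) ∧ μ' j = Measure.map (descend F ℰp j) (μ' (j + 1))) ∧ (StrictMono (φ ∘ ψ) ∧ ∀ os : List (ULoop3 F), Tendsto (fun i => (F.scheme ℰp γ).expectAt ((φ ∘ ψ) i) os) atTop (𝓝 (∫ u, (os.map fun C => loopAt u (C.1.atLevel 0)).prod ∂(μ 0)))) ∧ (StrictMono (φ' ∘ ψ') ∧ ∀ os : List (ULoop3 F), Tendsto (fun i => (F.scheme ℰp γ).expectAt ((φ' ∘ ψ') i) os) atTop (𝓝 (∫ u, (os.map fun C => loopAt u (C.1.atLevel 0)).prod ∂(μ' 0)))) ∧ (∀ j : ℕ, j₀ ≤ j → ∃ r r' : GaugeField (F.P j) 0 ↥(Matrix.specialUnitaryGroup (Fin 2) ℂ) → ℝ, Measurable r ∧ Measurable r' ∧ (∀ U, 0 ≤ r U ∧ 0 ≤ r' U) ∧ (∀ U, PlaqSmall (δ j) U → 0 < r U ∧ 0 < r' U) ∧ μ j = (fieldMeasure (F.P j) 0 ↥(Matrix.specialUnitaryGroup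 (Fin 2) ℂ)).withDensity (fun U => ENNReal.ofReal (r U)) ∧ μ' j = (fieldMeasure (F.P j) 0 ↥(Matrix.specialUnitaryGroup (Fin 2) ℂ)).withDensity (fun U => ENNReal.ofReal (r' U)) ∧ (∀ (b : PBond (F.P j) 0) (U V : GaugeField (F.P j) 0 ↥(Matrix.specialUnitaryGroup (Fin 2) ℂ)), PlaqSmall (δ j) U → PlaqSmall (δ j) V → (∀ c : PBond (F.P j) 0, c ≠ b → U c = V c) → |(Real.log (r U) - Real.log (r' U)) - (Real.log (r V) - Real.log (r' V))| ≤ ω j) ∧ (∀ (b b' : PBond (F.P j) 0) (U V W Z : GaugeField (F.P j) 0 ↥(Matrix.specialUnitaryGroup (Fin 2) ℂ)), PlaqSmall (δ j) U → PlaqSmall (δ j) V → PlaqSmall (δ j) W → PlaqSmall (δ j) Z → (∀ c : PBond (F.P j) 0, c ≠ b → U c = V c) → (∀ c : PBond (F.P j) 0, c ≠ b' → U c = W c) → (∀ c : PBond (F.P j) 0, c ≠ b' → V c = Z c) → (∀ c : PBond (F.P j) 0, c ≠ b → W c = Z c) → |((Real.log (r U) - Real.log (r' U)) - (Real.log (r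 V) - Real.log (r' V))) - ((Real.log (r W) - Real.log (r' W)) - (Real.log (r Z) - Real.log (r' Z)))| ≤ ω j * Real.exp (-(κ * (b.src.tdist b'.src : ℝ)))) ∧ μ j {U | ¬ PlaqSmall (δ j) U} ≤ ENNReal.ofReal (η j) ∧ μ' j {U | ¬ PlaqSmall (δ j) U} ≤ ENNReal.ofReal (η j)))
    (h₂ : open MeasureTheory Filter Topology Literature.MathematicalPhysics.QuantumFieldTheory.Balaban1983to89 Literature.MathematicalPhysics.QuantumFieldTheory.Balaban1983to89.T3ContinuumYM3Torus Literature.MathematicalPhysics.QuantumFieldTheory.Balaban1983to89.T3NestedUnitLaws Literature.MathematicalPhysics.QuantumFieldTheory.Balaban1983to89.T3UnitLawDensityEML Literature.MathematicalPhysics.QuantumFieldTheory.Balaban1983to89.T4Continuum in ∃ γ₁ : ℝ, 0 < γ₁ ∧ ∀ (F : T3Family) (γ : ℝ), 0 < γ → γ ≤ γ₁ → ∀ (κ : ℝ) (j₀ : ℕ) (δ ω η : ℕ → ℝ), 0 < κ → (∀ j, 0 < δ j ∧ 0 ≤ ω j ∧ 0 ≤ η j) → Summable ω → Summable η → ∃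 (T : Finset (List (ULoop3 F))) (ρ : ℝ), 0 < ρ ∧ ∀ (θ θ' : ℕ → ℕ) (μ μ' : ((j : ℕ) → MeasureTheory.Measure (GaugeField (F.P j) 0 ↥(Matrix.specialUnitaryGroup (Fin 2) ℂ)))),  (∀ j : ℕ, IsProbabilityMeasure (μ j) ∧ μ j = Measure.map (descend F ℰp j) (μ (j + 1))) → (∀ j : ℕ, IsProbabilityMeasure (μ' j) ∧ μ' j = Measure.map (descend F ℰp j) (μ' (j + 1))) → (StrictMono θ ∧ ∀ os : List (ULoop3 F), Tendsto (fun i => (F.scheme ℰp γ).expectAt (θ i) os) atTop (𝓝 (∫ u, (os.map fun C => loopAt u (C.1.atLevel 0)).prod ∂(μ 0)))) → (StrictMono θ' ∧ ∀ os : List (ULoop3 F), Tendsto (fun i => (F.scheme ℰp γ).expectAt (θ' i) os) atTop (𝓝 (∫ u, (os.map fun C => loopAt u (C.1.atLevel 0)).prod ∂(μ' 0)))) → (∀ j : ℕ, j₀ ≤ j → ∃ r r' : GaugeField (F.P j) 0 ↥(Matrix.specialUnitaryGroup (Fin 2) ℂ) → ℝ, Measurable r ∧ Measurable r' ∧ (∀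 U, 0 ≤ r U ∧ 0 ≤ r' U) ∧ (∀ U, PlaqSmall (δ j) U → 0 < r U ∧ 0 < r' U) ∧ μ j = (fieldMeasure (F.P j) 0 ↥(Matrix.specialUnitaryGroup (Fin 2) ℂ)).withDensity (fun U => ENNReal.ofReal (r U)) ∧ μ' j = (fieldMeasure (F.P j) 0 ↥(Matrix.specialUnitaryGroup (Fin 2) ℂ)).withDensity (fun U => ENNReal.ofReal (r' U)) ∧ (∀ (b : PBond (F.P j) 0) (U V : GaugeField (F.P j) 0 ↥(Matrix.specialUnitaryGroup (Fin 2) ℂ)), PlaqSmall (δ j) U → PlaqSmall (δ j) V → (∀ c : PBond (F.P j) 0, c ≠ b → U c = V c) → |(Real.log (r U) - Real.log (r' U)) - (Real.log (r V) - Real.log (r' V))| ≤ ω j) ∧ (∀ (b b' : PBond (F.P j) 0) (U V W Z : GaugeField (F.P j) 0 ↥(Matrix.specialUnitaryGroup (Fin 2) ℂ)), PlaqSmall (δ j) U → PlaqSmall (δ j) V → PlaqSmall (δ j) W → PlaqSmall (δ j) Z → (∀ c : PBond (F.P j) 0, c ≠ b → U c = V c) → (∀ c : PBond (F.P j) 0,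 c ≠ b' → U c = W c) → (∀ c : PBond (F.P j) 0, c ≠ b' → V c = Z c) → (∀ c : PBond (F.P j) 0, c ≠ b → W c = Z c) → |((Real.log (r U) - Real.log (r' U)) - (Real.log (r V) - Real.log (r' V))) - ((Real.log (r W) - Real.log (r' W)) - (Real.log (r Z) - Real.log (r' Z)))| ≤ ω j * Real.exp (-(κ * (b.src.tdist b'.src : ℝ)))) ∧ μ j {U | ¬ PlaqSmall (δ j) U} ≤ ENNReal.ofReal (η j) ∧ μ' j {U | ¬ PlaqSmall (δ j) U} ≤ ENNReal.ofReal (η j)) → (∀ Cs ∈ T, |(∫ u, (Cs.map fun C => loopAt u (C.1.atLevel 0)).prod ∂(μ 0)) - (∫ u, (Cs.map fun C => loopAt u (C.1.atLevel 0)).prod ∂(μ' 0))| < ρ) → ∀ os : List (ULoop3 F), (∫ u, (os.map fun C => loopAt u (C.1.atLevel 0)).prod ∂(μ 0)) = (∫ u, (os.map fun C => loopAt u (C.1.atLevel 0)).prod ∂(μ' 0))) :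
    Summit.QuantumFields.YangMills.Theses.LimitSetRigidity.IsolatedLimitPointsL := by
  obtain ⟨γA, hγA, hA⟩ := h₁
  obtain ⟨γB, hγB, hB⟩ := h₂
  refine ⟨min γA γB, lt_min hγA hγB, fun F γ hγ hγle => ?_⟩
  obtain ⟨κ, j₀, δ, ω, η, hκ, hpos, hω, hη, hpair⟩ := hA F γ hγ (hγle.trans (min_le_left _ _))
  obtain ⟨T, ρ, hρ, hloc⟩ := hB F γ hγ (hγle.trans (min_le_right _ _)) κ j₀ δ ω η hκ hpos hω hη
  refine ⟨T, ρ, hρ, fun φ ψ E E' hφ hψ hE hE' hclose => ?_⟩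
  obtain ⟨ψ₁, ψ₁', hψ₁, hψ₁', μ, μ', hμc, hμ'c, hreal, hreal', hUV⟩ := hpair φ ψ hφ hψ
  have hEq : ∀ os : List (ULoop3 F), E os = ∫ u, (os.map fun C => loopAt u (C.1.atLevel 0)).prod ∂(μ 0) := by
    intro os
    have h1 : Tendsto (fun i => (F.scheme ℰp γ).expectAt ((φ ∘ ψ₁) i) os) atTop (𝓝 (E os)) :=
      (hE os).comp hψ₁.tendsto_atTop
    exact tendsto_nhds_unique h1 (hreal.2 os)
  have hEq' : ∀ os : List (ULoop3 F), E' os = ∫ u, (os.map fun C => loopAt u (C.1.atLevel 0)).prod ∂(μ' 0) := by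
    intro os
    have h1 : Tendsto (fun i => (F.scheme ℰp γ).expectAt ((ψ ∘ ψ₁') i) os) atTop (𝓝 (E' os)) :=
      (hE' os).comp hψ₁'.tendsto_atTop
    exact tendsto_nhds_unique h1 (hreal'.2 os)
  have hint := hloc (φ ∘ ψ₁) (ψ ∘ ψ₁') μ μ' hμc hμ'c hreal hreal' hUV
    (fun Cs hCs => by rw [← hEq Cs, ← hEq' Cs]; exact hclose Cs hCs)
  funext os
  rw [hEq os, hEq' os, hint os]

/-- KERNEL-CHECKED COMPARISON WITH LINE 2: the GLOBAL rigidity crux `UVRigidity` (stmt-QuantumFields-26904) implies STUB 2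
(take `T := ∅`, `ρ := 1`; the closeness and second-realisation hypotheses are dropped).  Hence LINE 2's two cruxes imply LINE 3's crux B. -/
theorem localUVRigidity_of_uvRigidity
    (h : Summit.QuantumFields.YangMills.Theses.UVClassRigidity.UVRigidity) :
    open MeasureTheory Filter Topology Literature.MathematicalPhysics.QuantumFieldTheory.Balaban1983to89 Literature.MathematicalPhysics.QuantumFieldTheory.Balaban1983to89.T3ContinuumYM3Torus Literature.MathematicalPhysics.QuantumFieldTheory.Balaban1983to89.T3NestedUnitLaws Literature.MathematicalPhysics.QuantumFieldTheory.Balaban1983to89.T3UnitLawDensityEML Literature.MathematicalPhysics.QuantumFieldTheory.Balaban1983to89.T4Continuum in ∃ γ₁ : ℝ, 0 < γ₁ ∧ ∀ (F : T3Family) (γ : ℝ), 0 < γ → γ ≤ γ₁ → ∀ (κ : ℝ) (j₀ : ℕ) (δ ω η : ℕ → ℝ), 0 < κ → (∀ j, 0 < δ j ∧ 0 ≤ ω j ∧ 0 ≤ η j) → Summable ω → Summable η → ∃ (T : Finset (List (ULoop3 F))) (ρ : ℝ), 0 < ρ ∧ ∀ (θ θ' : ℕ → ℕ) (μ μ' :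 ((j : ℕ) → MeasureTheory.Measure (GaugeField (F.P j) 0 ↥(Matrix.specialUnitaryGroup (Fin 2) ℂ)))),  (∀ j : ℕ, IsProbabilityMeasure (μ j) ∧ μ j = Measure.map (descend F ℰp j) (μ (j + 1))) → (∀ j : ℕ, IsProbabilityMeasure (μ' j) ∧ μ' j = Measure.map (descend F ℰp j) (μ' (j + 1))) → (StrictMono θ ∧ ∀ os : List (ULoop3 F), Tendsto (fun i => (F.scheme ℰp γ).expectAt (θ i) os) atTop (𝓝 (∫ u, (os.map fun C => loopAt u (C.1.atLevel 0)).prod ∂(μ 0)))) → (StrictMono θ' ∧ ∀ os : List (ULoop3 F), Tendsto (fun i => (F.scheme ℰp γ).expectAt (θ' i) os) atTop (𝓝 (∫ u, (os.map fun C => loopAt u (C.1.atLevel 0)).prod ∂(μ' 0)))) → (∀ j : ℕ, j₀ ≤ j → ∃ r r' : GaugeField (F.P j) 0 ↥(Matrix.specialUnitaryGroup (Fin 2) ℂ) → ℝ, Measurable r ∧ Measurable r' ∧ (∀ U, 0 ≤ r U ∧ 0 ≤ r' U) ∧ (∀ U, PlaqSmall (δ j) U → 0 < r U ∧ 0 <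 r' U) ∧ μ j = (fieldMeasure (F.P j) 0 ↥(Matrix.specialUnitaryGroup (Fin 2) ℂ)).withDensity (fun U => ENNReal.ofReal (r U)) ∧ μ' j = (fieldMeasure (F.P j) 0 ↥(Matrix.specialUnitaryGroup (Fin 2) ℂ)).withDensity (fun U => ENNReal.ofReal (r' U)) ∧ (∀ (b : PBond (F.P j) 0) (U V : GaugeField (F.P j) 0 ↥(Matrix.specialUnitaryGroup (Fin 2) ℂ)), PlaqSmall (δ j) U → PlaqSmall (δ j) V → (∀ c : PBond (F.P j) 0, c ≠ b → U c = V c) → |(Real.log (r U) - Real.log (r' U)) - (Real.log (r V) - Real.log (r' V))| ≤ ω j) ∧ (∀ (b b' : PBond (F.P j) 0) (U V W Z : GaugeField (F.P j) 0 ↥(Matrix.specialUnitaryGroup (Fin 2) ℂ)), PlaqSmall (δ j) U → PlaqSmall (δ j) V → PlaqSmall (δ j) W → PlaqSmall (δ j) Z → (∀ c : PBond (F.P j) 0, c ≠ b → U c = V c) → (∀ c : PBond (F.P j) 0, c ≠ b' → U c = W c) → (∀ c : PBond (F.P j) 0, c ≠ b' → V c = Z c) → (∀ c : PBond (F.P j)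 0, c ≠ b → W c = Z c) → |((Real.log (r U) - Real.log (r' U)) - (Real.log (r V) - Real.log (r' V))) - ((Real.log (r W) - Real.log (r' W)) - (Real.log (r Z) - Real.log (r' Z)))| ≤ ω j * Real.exp (-(κ * (b.src.tdist b'.src : ℝ)))) ∧ μ j {U | ¬ PlaqSmall (δ j) U} ≤ ENNReal.ofReal (η j) ∧ μ' j {U | ¬ PlaqSmall (δ j) U} ≤ ENNReal.ofReal (η j)) → (∀ Cs ∈ T, |(∫ u, (Cs.map fun C => loopAt u (C.1.atLevel 0)).prod ∂(μ 0)) - (∫ u, (Cs.map fun C => loopAt u (C.1.atLevel 0)).prod ∂(μ' 0))| < ρ) → ∀ os : List (ULoop3 F), (∫ u, (os.map fun C => loopAt u (C.1.atLevel 0)).prod ∂(μ 0)) = (∫ u, (os.map fun C => loopAt u (C.1.atLevel 0)).prod ∂(μ' 0)) := by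
  obtain ⟨γ₁, hγ₁, hR⟩ := h
  refine ⟨γ₁, hγ₁, fun F γ hγ hγle κ j₀ δ ω η hκ hpos hω hη => ⟨∅, 1, one_pos, ?_⟩⟩
  intro θ θ' μ μ' hμc hμ'c hreal _hreal' hUV _hclose
  exact hR F γ hγ hγle κ j₀ δ ω η hκ hpos hω hη θ μ μ' hμc hμ'c hreal hUV

/-- LINE 2 ⇒ crux B of LINE 3 (kernel-checked corollary). -/
theorem isolatedLimitPointsL_of_line2
    (hA : Summit.QuantumFields.YangMills.Theses.UVClassRigidity.LimitTrajectoriesUVEquivalent)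
    (hB : Summit.QuantumFields.YangMills.Theses.UVClassRigidity.UVRigidity) :
    Summit.QuantumFields.YangMills.Theses.LimitSetRigidity.IsolatedLimitPointsL :=
  IsolatedLimitPointsL_of₂ (stub1_iff.mpr hA) (localUVRigidity_of_uvRigidity hB)

/-- The registered-skeleton form. -/
theorem isolatedLimitPointsL_of_stubs₂ : Summit.QuantumFields.YangMills.Theses.LimitSetRigidity.IsolatedLimitPointsL :=
  IsolatedLimitPointsL_of₂ stub_limitTrajectoriesUVEquivalent stub_localUVRigidity

end Cruxes.IsolatedLimitPointsL.Birth2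

end Summit.QuantumFields.YangMills.Theses.LimitSetRigidity
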